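import Mathlib
import Literature.Analysis.FunctionSpaces.ContDiffHolderEvaluation
import Summits.SmoothPoincare4.SmoothPoincare4.Theorems.SullivanDualTameOrBrodyR4CoreAChartImplicit

/-!
# CORE-A of crux `TameOrBrodyR4` (stmt-SmoothPoincare4-7826), line `Sketch`: joint finite-order
# smoothness of the implicit-function family (registered helper `helper_familyHigherOrder`, FAMb)

The order-`0` implicit function `γ : ball 0 ε₀ → C^{0,r}_b` of the vorticity map of a chart `𝒞` at
a pencil member `u₀` (`…CoreAChartImplicit.lean`) defines the family of maps
`Φ b ξ = u₀ ξ + Ψ ξ ((0, b - b₀) + T(χ₁ γ(b - b₀)) ξ)`. We prove that `(b, ξ) ↦ Φ b ξ` is jointly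
`C^m` on `ball b₀ ε × ℂ` for some `ε > 0`, for every finite `m`:

* the SAME implicit function theorem at order `m` (`helper_chartImplicitFunction … m`) gives a
  smooth `γ_m : ball 0 ε_m → C^{m,r}_b` of zeros of the order-`m` vorticity map with `γ_m 0 = 0`;
* the vorticity map has the same pointwise formula at every order (`ChartData.G_apply_eq`), so
  `γ_m β` read at order `0` (`toOrderZero`; continuous by the closed graph theorem,
  `continuous_toOrderZero`) is a zero of the order-`0` map, small for `β` near `0` by continuity;
  by the order-`0` uniqueness `huniq` it is `γ β`, so `⇑(γ_m β) = ⇑(γ β)` near `0`;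
* hence near `b₀` the family is `(b, ξ) ↦ u₀ ξ + Ψ ξ (Λ (b - b₀) ξ)` with the `C^∞` map
  `Λ β = W(β, γ_m β) ∈ C^{m+1,r}_b`, and point evaluation of such maps is jointly `C^m`
  (`ContDiffHolderFunction.contDiffOn_eval`).
-/

-- the registered namespace `Summit.SmoothPoincare4.SmoothPoincare4.…` repeats a component
set_option linter.dupNamespace false
set_option maxSynthPendingDepth 3

noncomputable section

open scoped ContDiff Topology NNReal
open Filter Set Function Metric Literature.Analysis.Complex Literature.Analysis.FunctionSpaces
  Literature.Analysis.Calculus Literature.Geometry.Symplectic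

namespace Summit.SmoothPoincare4.SmoothPoincare4.Cruxes.TameOrBrodyR4.Sketch

/-- Local notation for the model space `ℝ⁴ = EuclideanSpace ℝ (Fin 4)`. -/
local notation "E4" => EuclideanSpace ℝ (Fin 4)

namespace CoreA

namespace ChartData

variable {r : ℝ≥0} {k : ℕ}

/-- **Order reduction to `0` is continuous** `C^{k,r}_b → C^{0,r}_b`: it is linear with continuous
point evaluations (closed graph theorem, `ContDiffHolderFunction.continuous_of_continuous_eval`). -/
theorem continuous_toOrderZero (hr1 : r < 1) :
    Continuous (toOrderZero hr1 :
      ContDiffHolderFunction ℂ (ℂ × ℂ) k r → ContDiffHolderFunction ℂ (ℂ × ℂ) 0 r) :=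
  ContDiffHolderFunction.continuous_of_continuous_eval
    ({ toFun := toOrderZero hr1
       map_add' := fun _ _ => ContDiffHolderFunction.ext fun _ => rfl
       map_smul' := fun _ _ => ContDiffHolderFunction.ext fun _ => rfl } :
      ContDiffHolderFunction ℂ (ℂ × ℂ) k r →ₗ[ℝ] ContDiffHolderFunction ℂ (ℂ × ℂ) 0 r)
    fun x => (ContDiffHolderFunction.evalCLM (E := ℂ) (F := ℂ × ℂ) (k := k) (r := r) x).continuous

/-- `toOrderZero hr1 0 = 0`. -/
@[simp] theorem toOrderZero_zero (hr1 : r < 1) :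
    toOrderZero hr1 (0 : ContDiffHolderFunction ℂ (ℂ × ℂ) k r) = 0 :=
  ContDiffHolderFunction.ext fun _ => rfl

/-- The underlying function of `toOrderZero hr1 g` is that of `g`. -/
@[simp] theorem coe_toOrderZero (hr1 : r < 1) (g : ContDiffHolderFunction ℂ (ℂ × ℂ) k r) :
    ((toOrderZero hr1 g : ContDiffHolderFunction ℂ (ℂ × ℂ) 0 r) : ℂ → ℂ × ℂ) = g := rfl

variable {J : E4 → E4 →L[ℝ] E4} {R : ℝ} {P Q : E4 →L[ℝ] ℂ} {eP eQ : ℂ →L[ℝ] E4} {b₀ : ℂ}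
  {u₀ : ℂ → E4} (𝒞 : ChartData J R P Q eP eQ b₀ u₀)
  (hr0 : 0 < r) (hr1 : r < 1) (hJs : ContDiff ℝ ∞ J) (hu₀s : ContDiff ℝ ∞ u₀)

/-- **The vorticity map does not depend on the order**: the order-`0` vorticity map at
`(β, toOrderZero g)` is, pointwise, the order-`k` vorticity map at `(β, g)`. -/
theorem G_toOrderZero_apply (β : ℂ) (g : ContDiffHolderFunction ℂ (ℂ × ℂ) k r) (x : ℂ) :
    (𝒞.vorticity hr0 hr1 hJs hu₀s 0).G hr1.le (β, toOrderZero hr1 g) x =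
      (𝒞.vorticity hr0 hr1 hJs hu₀s k).G hr1.le (β, g) x := by
  rw [G_apply_eq, G_apply_eq]
  rfl

end ChartData

end CoreA

/-- **Registered helper `helper_familyHigherOrder`** (FAMb): joint `C^m` smoothness near `b₀` of
the family `(b, ξ) ↦ u₀ ξ + Ψ ξ ((0, b - b₀) + T(χ₁ γ(b - b₀)) ξ)` built from the order-`0`
implicit function `γ` of the vorticity map: the order-`m` implicit function `γ_m` has the same
small zeros read at order `0`, so `γ_m = γ` near `0` as functions, and point evaluation of the
`C^∞` map `β ↦ W(β, γ_m β) ∈ C^{m+1,r}_b` is jointly `C^m`. -/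
theorem helper_familyHigherOrder (J : E4 → E4 →L[ℝ] E4) (R : ℝ) (P Q : E4 →L[ℝ] ℂ)
    (eP eQ : ℂ →L[ℝ] E4) (hR : 0 < R) (hJs : ContDiff ℝ ∞ J) (hJ2 : ∀ x v, J x (J x v) = -v)
    (hPQ : IsCoordFrame P Q eP eQ)
    (hJP : ∀ x : E4, R ≤ ‖x‖ → ∀ v, P (J x v) = Complex.I * P v)
    (hJQ : ∀ x : E4, R ≤ ‖x‖ → ∀ v, Q (J x v) = Complex.I * Q v)
    {r : ℝ≥0} (hr0 : 0 < r) (hr1 : r < 1)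
    (b₀ : ℂ) (u₀ : ℂ → E4) (hu₀ : IsPencilMember J R P Q b₀ u₀)
    (𝒞 : CoreA.ChartData J R P Q eP eQ b₀ u₀) (ε₀ δ₀ : ℝ) (hε₀ : 0 < ε₀) (hδ₀ : 0 < δ₀)
    (γ : ℂ → ContDiffHolderFunction ℂ (ℂ × ℂ) 0 r) (hγs : ContDiffOn ℝ ∞ γ (ball 0 ε₀))
    (hγ0 : γ 0 = 0)
    (huniq : ∀ β ∈ ball (0 : ℂ) ε₀, ∀ g ∈ ball (0 : ContDiffHolderFunction ℂ (ℂ × ℂ) 0 r) δ₀,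
      (𝒞.vorticity hr0 hr1 hJs hu₀.1 0).G hr1.le (β, g) = 0 → g = γ β) (m : ℕ) :
    ∃ ε > (0 : ℝ), ContDiffOn ℝ m (fun p : ℂ × ℂ => u₀ p.2 + 𝒞.Ψ p.2 (((0 : ℂ), p.1 - b₀) +
      cauchyTransformAlong (1 : ℂ) (fun w => 𝒞.χ₁ w • γ (p.1 - b₀) w) p.2))
      (ball b₀ ε ×ˢ univ) := by
  -- `γ`'s own smoothness and normalisation are not needed: `γ` is identified with `γ_m` below
  have _ := hγs
  have _ := hγ0
  -- (1) the implicit function at order `m`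
  obtain ⟨εm, hεm, δm, _, γm, hγms, hγm0, -, hγmz, -⟩ :=
    helper_chartImplicitFunction J R P Q eP eQ hR hJs hJ2 hPQ hJP hJQ hr0 hr1 b₀ u₀ hu₀ 𝒞 m
  -- (2) smallness at order `0` near `β = 0`
  have hcont : ContinuousAt (fun β => CoreA.ChartData.toOrderZero (k := m) hr1 (γm β)) 0 :=
    (CoreA.ChartData.continuous_toOrderZero (k := m) hr1).continuousAt.comp
      (hγms.continuousOn.continuousAt (isOpen_ball.mem_nhds (mem_ball_self hεm)))
  have hev : ∀ᶠ β in 𝓝 (0 : ℂ), CoreA.ChartData.toOrderZero (k := m) hr1 (γm β) ∈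
      ball (0 : ContDiffHolderFunction ℂ (ℂ × ℂ) 0 r) δ₀ := by
    refine hcont.preimage_mem_nhds (isOpen_ball.mem_nhds ?_)
    show CoreA.ChartData.toOrderZero (k := m) hr1 (γm 0) ∈
      ball (0 : ContDiffHolderFunction ℂ (ℂ × ℂ) 0 r) δ₀
    rw [hγm0, CoreA.ChartData.toOrderZero_zero]
    exact mem_ball_self hδ₀
  obtain ⟨ε₁, hε₁, hball⟩ := Metric.eventually_nhds_iff_ball.1 hev
  -- the radius
  refine ⟨min ε₁ (min εm ε₀), lt_min hε₁ (lt_min hεm hε₀), ?_⟩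
  set ε : ℝ := min ε₁ (min εm ε₀)
  have hε₁' : ε ≤ ε₁ := min_le_left _ _
  have hεm' : ε ≤ εm := (min_le_right _ _).trans (min_le_left _ _)
  have hε₀' : ε ≤ ε₀ := (min_le_right _ _).trans (min_le_right _ _)
  -- (3) the order-`m` implicit function agrees with `γ` near `0`, as functions
  have hkey : ∀ β ∈ ball (0 : ℂ) ε,
      ((γm β : ContDiffHolderFunction ℂ (ℂ × ℂ) m r) : ℂ → ℂ × ℂ) = γ β := by
    intro β hβ
    have hβm : β ∈ ball (0 : ℂ) εm := ball_subset_ball hεm' hβ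
    have hz : (𝒞.vorticity hr0 hr1 hJs hu₀.1 0).G hr1.le
        (β, CoreA.ChartData.toOrderZero hr1 (γm β)) = 0 := by
      refine ContDiffHolderFunction.ext fun x => ?_
      rw [CoreA.ChartData.G_toOrderZero_apply, hγmz β hβm]
      rfl
    have h := huniq β (ball_subset_ball hε₀' hβ) (CoreA.ChartData.toOrderZero hr1 (γm β))
      (hball β (ball_subset_ball hε₁' hβ)) hz
    simpa using congrArg DFunLike.coe h
  -- (4) the smooth `C^{m+1,r}_b`-valued map `Λ β = W(β, γ_m β)` (kept opaque for the unifier)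
  obtain ⟨Λ, hΛdef⟩ : ∃ Λ : ℂ → ContDiffHolderFunction ℂ (ℂ × ℂ) (m + 1) r,
      Λ = fun β => (𝒞.vorticity hr0 hr1 hJs hu₀.1 m).W (β, γm β) := ⟨_, rfl⟩
  have hpair : ContDiffOn ℝ ∞ (fun β : ℂ => (β, γm β)) (ball 0 ε) :=
    contDiffOn_id.prodMk (hγms.mono (ball_subset_ball hεm'))
  have hΛ' : ContDiffOn ℝ ∞ Λ (ball 0 ε) := by
    rw [hΛdef]
    exact (𝒞.vorticity hr0 hr1 hJs hu₀.1 m).W.contDiff.comp_contDiffOn hpair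
  have hΛ : ContDiffOn ℝ m Λ (ball 0 ε) := hΛ'.of_le (by exact_mod_cast le_top)
  -- (5) joint smoothness of `(β, ξ) ↦ Λ β ξ`, then of the family
  have heval : ContDiffOn ℝ m (fun p : ℂ × ℂ => Λ p.1 p.2) (ball 0 ε ×ˢ univ) :=
    ContDiffHolderFunction.contDiffOn_eval (n := m) (by exact_mod_cast Nat.le_succ m) Λ
      isOpen_ball hΛ
  have hsub : ContDiffOn ℝ m (fun p : ℂ × ℂ => (p.1 - b₀, p.2)) (ball b₀ ε ×ˢ univ) :=
    ((contDiff_fst.sub contDiff_const).prodMk contDiff_snd).contDiffOn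
  have hmaps : MapsTo (fun p : ℂ × ℂ => (p.1 - b₀, p.2)) (ball b₀ ε ×ˢ univ)
      (ball (0 : ℂ) ε ×ˢ univ) := by
    intro p hp
    refine mem_prod.2 ⟨?_, mem_univ _⟩
    have hp1 : p.1 ∈ ball b₀ ε := (mem_prod.1 hp).1
    simpa [mem_ball, dist_eq_norm] using hp1
  have hshift : ContDiffOn ℝ m (fun p : ℂ × ℂ => Λ (p.1 - b₀) p.2) (ball b₀ ε ×ˢ univ) :=
    heval.comp hsub hmaps
  have hF : ContDiffOn ℝ m (fun p : ℂ × ℂ => u₀ p.2 + 𝒞.Ψ p.2 (Λ (p.1 - b₀) p.2))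
      (ball b₀ ε ×ˢ univ) :=
    ((hu₀.1.of_le (by exact_mod_cast le_top)).comp contDiff_snd).contDiffOn.add
      (((𝒞.hΨs.of_le (by exact_mod_cast le_top)).comp contDiff_snd).contDiffOn.clm_apply hshift)
  -- (6) the family is this function on `ball b₀ ε × ℂ`
  refine hF.congr fun p hp => ?_
  have hp1 : p.1 ∈ ball b₀ ε := (mem_prod.1 hp).1
  have hβ : p.1 - b₀ ∈ ball (0 : ℂ) ε := by simpa [mem_ball, dist_eq_norm] using hp1
  simp only [hΛdef, CoreA.ChartData.coe_W, hkey _ hβ]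

end Summit.SmoothPoincare4.SmoothPoincare4.Cruxes.TameOrBrodyR4.Sketch
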